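import Summits.Ventures.CertifiedManyBodySolver.Observables.StiffnessApexTransportWeightedBracket
import HarnessLib

/-!
# Ventures/CertifiedManyBodySolver — Observables/StiffnessApexTransportFermiSeaAnchor.lean

HONEST FRAMING: one-sided certified CEILINGS on the uniform flux stiffness (t–t′ f-sum class) at ANY density, transported to a target OFF the apex curve
of ONE solved source by interpolating the target's one-body functional between the source's apex hopping and a KERNEL FERMI-SEA ROW at a second hopping;
every leaf is CONDITIONAL on the source rows / row families it names (the Fermi-sea rows are hypothesis-free kernel theorems); a ceiling never speaks to the
presence of order; not a `T_c` estimate, not a superconductivity verdict; no number of record. Zero compute, no definition, no claim node, no `sorry`.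

Cell `pub/hubbard-fast` (D-0154 (1)(A) «CERTIFICATE REUSE along parameter paths»), seat `hubbard-fast-reuse-2` g4 (`prover-hubbard-fast-reuse-2-g4-0`), path family
«APEX TRANSPORT», line «FERMI-SEA ANCHOR»: the REUSE LEMMA in generic form. Companion of this seat's `Observables/StiffnessApexTransportWeightedBracket.lean` (g3, p650211/p654366:
TWO interacting apex sources bracketing the target) — here the second source is the FREE FERMI SEA, i.e. the apex source at station `U = 0`, whose «word» at ANY
hopping `κ₂` is a kernel Fermi-sea row `ℓ ≤ e(1, κ₂, 0, n)` (`Literature/…/HubbardFermiSeaCellRows` §5, `…/HubbardFermiSeaTangentRows*`, `…/HubbardFermiSeaCornerRows`;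
Lieb–Loss bathtub principle), read on the TARGET state by the torus-limit variational row `IsTorusLimitOf.energyDensityTT'_le_meanEnergy_hubbardTTPrime` at the
coupling `(1, κ₂, 0)`.

THE POINT. For a target `P = (t′_P, U_P)`, density `0 ≤ n < 2`, and ONE source `A₁ = (s₁, U₁)`, `0 ≤ U₁ < U_P`, the apex row
(`IsTorusLimitOf.meanEnergy_apexHopping_le_of_groundStates`) transports a certified floor `ℓ₁ ≤ e_{Φ(1,κ₁,0)}(ω_{A₁})` to the target class at the hopping
`κ₁ = (U_P s₁ − U₁ t′_P)/(U_P − U₁)`; at ANY other hopping `κ₂` the target's functional obeys `e_{Φ(1,κ₂,0)}(ω_P) ≥ e(1, κ₂, 0, n) ≥ ℓ₂` (free-gas floor at density `n`,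
no geometry). The functional `κ ↦ e_{Φ(1,κ,0)}(ω_P)` is AFFINE (`meanEnergy_hubbardTTPrime_eq_coords`), so for weights `μ₁, μ₂ ≥ 0`, `μ₁ + μ₂ = 1`, `μ₁κ₁ + μ₂κ₂ = 2t′_P`
(they exist iff `2t′_P` lies between `κ₁` and `κ₂` — EITHER order):

  `e_{Φ(1,2t′_P,0)}(ω_P) = μ₁·e_{Φ(1,κ₁,0)}(ω_P) + μ₂·e_{Φ(1,κ₂,0)}(ω_P) ≥ μ₁ℓ₁ + μ₂ℓ₂`, hence `ObsStiffnessSeqCeilingAt t′_P U_P n c` for `c ≥ −(μ₁ℓ₁ + μ₂ℓ₂)/4`.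

WHY IT HAS CONTENT although `−ℓ₂/4` is never below the one-body value: the free stiffness curve `κ ↦ −e(1,κ,0,n)/4` is convex and (at `n = 7/8`) nearly flat
(`0.3906` at `κ = −3/10`, `0.4026` at `0`, `0.4110` at `1/10`, kernel values), while an interacting apex word sits `0.02–0.03` below it; the chord from `(κ₁, W₁)` to a FAR
free point therefore passes under the free value at `2t′_P` for every `2t′_P` up to the tangency hopping. At `μ₂ = 1` the lemma is the kinematic leaf
`ObsStiffnessSeqCeilingAt_of_freeEnergyFloor_twice_tPrime`; at `μ₁ = 1` it is the single-source apex leaf.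

* §1 `ObsStiffnessSeqCeilingAt_of_apexSource_fermiSeaRow_weighted` — functional master (source floor `ℓ₁` of any provenance, Fermi-sea floor `ℓ₂`);
* §2 the source floor in the shapes the tree delivers: an orbit-lower family for an END objective at the slot `2σ₁ = κ₁` (`…_of_slot_fermiSeaRow`, lever zero), the
  source's OWN f-sum orbit-lower family plus a `K₂` FLOOR (orientation `2s₁ ≤ κ₁`, `…_of_fsumFloor_fermiSeaRow`) or plus a `K₂` CEILING (orientation `κ₁ ≤ 2s₁`,
  `…_of_fsumCeil_fermiSeaRow`), and the registry-row edition (`…_of_fsumRow_fermiSeaRow`);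
* §3 arithmetic: the weights when the Fermi-sea hopping lies to the LEFT of `2t′_P` (`anchor_weights_left`; the right case is `bracket_weights` of the companion).

NOT said: nothing flows toward `U < U₁`; a pair of Fermi-sea rows alone never beats the kinematic leaf (convexity); the quality is set by the source word, by the
certified free floor at `κ₂` and by the distance `|κ₂ − κ₁|`; `λ ≠ 0` words are not of this form; no `T > 0`.

References: T. Koma, H. Tasaki, J. Stat. Phys. 76 (1994) 745, §1 [KomaTasaki1994]; D. J. Scalapino, S. R. White, S.-C. Zhang, PRB 47 (1993) 7995, §II
[ScalapinoWhiteZhang1993]; T. Hazra, N. Verma, M. Randeria, PRX 9 (2019) 031049, eq. (4) [HazraVermaRanderia2019]; E. H. Lieb, M. Loss, Duke Math. J. 71 (1993) 337,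
§8 Theorem 8.2 [LiebLoss1993].
-/

noncomputable section

namespace Summit.Ventures.CertifiedManyBodySolver.Observables

open Literature.MathematicalPhysics.QuantumLattice
open Literature.MathematicalPhysics.QuantumLattice.ThermodynamicLimit
open Literature.MathematicalPhysics.QuantumFieldTheory
open Literature.Probability.LatticeModels
open Matrix Finset Filter Topology HubbardWave0
open scoped Matrix BigOperators ComplexOrder

/-! ## §1 The functional master: one apex row, one Fermi-sea row, barycentric weights at the target -/

section Master

variable {t'P UP n s₁ U₁ : ℝ}

/-- **APEX × FERMI-SEA WEIGHTED BRACKET (any density, functional form).** Target `(t′_P, U_P)`, density `0 ≤ n < 2`; one source `(s₁, U₁)` with `0 ≤ U₁ < U_P` and apex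
hopping `κ₁ = (U_P s₁ − U₁ t′_P)/(U_P − U₁)`; a second hopping `κ₂`; weights `μ₁, μ₂ ≥ 0`, `μ₁ + μ₂ = 1`, `μ₁κ₁ + μ₂κ₂ = 2t′_P`. If `ℓ₁ ≤ e_{Φ(1,κ₁,0)}(ω)` for every torus limit
`ω` of unit `(rectN n L, S^z = 0)`-sector ground states of `hubbardTorusTT' L 1 s₁ U₁`, and `ℓ₂ ≤ e(1, κ₂, 0, n)` (a free-gas floor, e.g. a kernel Fermi-sea row), then
`ObsStiffnessSeqCeilingAt t′_P U_P n c` for every rational `c ≥ −(μ₁ℓ₁ + μ₂ℓ₂)/4`: the one-body functional of the target state is affine in the hopping, bounded below at `κ₁`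
by the transported source floor (apex row) and at `κ₂` by the free-gas floor (torus-limit variational row at coupling `(1, κ₂, 0)`).
[cite: KomaTasaki1994, §1] [cite: ScalapinoWhiteZhang1993, §II] [cite: LiebLoss1993, §8, Theorem 8.2] -/
theorem ObsStiffnessSeqCeilingAt_of_apexSource_fermiSeaRow_weighted (hU₁0 : 0 ≤ U₁) (hU₁ : U₁ < UP)
    (hn0 : 0 ≤ n) (hn2 : n < 2) {μ₁ μ₂ : ℝ} (hμ₁ : 0 ≤ μ₁) (hμ₂ : 0 ≤ μ₂) (hμ : μ₁ + μ₂ = 1) (κ₂ : ℝ)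
    (hκ : μ₁ * ((UP * s₁ - U₁ * t'P) / (UP - U₁)) + μ₂ * κ₂ = 2 * t'P) {ℓ₁ ℓ₂ : ℝ}
    (h₁ : ∀ (ω : InfVolFermionState 2) (Ls : ℕ → ℕ) (ψ : ∀ L, Fock (Orb (FermionTorus 2 L))),
      Tendsto Ls atTop atTop →
      (∀ j, IsGroundStateInSector (hubbardTorusTT' (Ls j) 1 s₁ U₁) (rectN n (Ls j)) 0 (ψ (Ls j))) →
      (∀ j, star (ψ (Ls j)) ⬝ᵥ ψ (Ls j) = 1) → ω.IsTorusLimitOf ψ Ls →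
      ℓ₁ ≤ ω.meanEnergy (hubbardTTPrimeFermionInteraction 1 ((UP * s₁ - U₁ * t'P) / (UP - U₁)) 0) 1)
    (h₂ : ℓ₂ ≤ energyDensityTT' 1 κ₂ 0 n)
    (c : ℚ) (hc : -(μ₁ * ℓ₁ + μ₂ * ℓ₂) / 4 ≤ ((c : ℚ) : ℝ)) :
    ObsStiffnessSeqCeilingAt t'P UP n c := by
  intro ρs θ₀ _ hθ₀ Ls hLs hst
  refine fluxStiffness_le_of_torusLimitTT'_oddMoment_orbit_certificate_seq t'P (U := UP) (δ := 1 - n) (q := ((c : ℚ) : ℝ)) 0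
    Finset.univ Finset.univ_nonempty (by linarith) (by linarith) hθ₀ hLs hst ?_
  intro ω Ms ψ hMs hψ h1 hω
  have hψ' : ∀ j, IsGroundStateInSector (hubbardTorusTT' (Ms j) 1 t'P UP) (rectN n (Ms j)) 0 (ψ (Ms j)) := fun j => by
    simpa only [sub_sub_cancel] using hψ j
  have hN : ∀ j, IsNParticle (rectN n (Ms j)) (ψ (Ms j)) := fun j => ((mem_szSector_iff _ _ _).1 (hψ' j).1).1
  rw [orbitMean_rotOddMomentLimitFunctionalTT_lam_zero_eq_meanEnergy_twice_tPrime hω.isTranslationInvariant]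
  obtain ⟨φ₁, g₁, ω₁, hg₁, hφ₁, hφ₁1, hω₁, -, -, -⟩ :=
    exists_isTorusLimitOf_sectorGroundState_TT' 1 s₁ U₁ hn0 hn2.le (Ls := id) tendsto_id
  have hL₁ : Tendsto (id ∘ g₁ : ℕ → ℕ) atTop atTop := tendsto_id.comp hg₁.tendsto_atTop
  -- the apex row, source → target, at the hopping `κ₁`
  have hapx₁ := InfVolFermionState.IsTorusLimitOf.meanEnergy_apexHopping_le_of_groundStates 1 s₁ t'P hU₁0 hU₁ hn0 hn2
    hω₁ hL₁ (fun j => hφ₁ _) (fun j => hφ₁1 _) hω hMs hψ' h1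
  -- the source floor
  have hl₁ := h₁ ω₁ (id ∘ g₁) φ₁ hL₁ (fun j => hφ₁ _) (fun j => hφ₁1 _) hω₁
  -- the Fermi-sea row, read on the TARGET state: torus-limit variational row at the coupling `(1, κ₂, 0)`
  have hfs := hω.energyDensityTT'_le_meanEnergy_hubbardTTPrime 1 κ₂ (U := 0) le_rfl hn0 hn2 hMs hN h1
  -- the one-body functional of the TARGET state is affine in the hopping
  set κ₁ : ℝ := (UP * s₁ - U₁ * t'P) / (UP - U₁) with hκ₁
  have e₁ := ω.meanEnergy_hubbardTTPrime_eq_coords 1 κ₁ 0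
  have e₂ := ω.meanEnergy_hubbardTTPrime_eq_coords 1 κ₂ 0
  have eP := ω.meanEnergy_hubbardTTPrime_eq_coords 1 (2 * t'P) 0
  have haff : ω.meanEnergy (hubbardTTPrimeFermionInteraction 1 (2 * t'P) 0) 1 =
      μ₁ * ω.meanEnergy (hubbardTTPrimeFermionInteraction 1 κ₁ 0) 1 +
        μ₂ * ω.meanEnergy (hubbardTTPrimeFermionInteraction 1 κ₂ 0) 1 := by
    rw [e₁, e₂, eP, ← hκ]
    linear_combination (ω.meanEnergy (hubbardTTPrimeFermionInteraction 1 0 0) 1) * hμ.symm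
  have hw₁ := mul_le_mul_of_nonneg_left (hl₁.trans hapx₁) hμ₁
  have hw₂ := mul_le_mul_of_nonneg_left (h₂.trans hfs) hμ₂
  have hc' : -(μ₁ * ℓ₁ + μ₂ * ℓ₂) / 4 ≤ ((c : ℚ) : ℝ) := hc
  rw [haff]
  linarith

end Master

/-! ## §2 The source floor in the shapes the tree delivers -/

section Shapes

variable {t'P UP n s₁ U₁ : ℝ}

/-- **APEX × FERMI-SEA, «slot» edition.** The source floor is an orbit-lower family for an END objective: `v₁ ≤ |D₄|⁻¹Σ_γ Re ω_γ(−X₀(σ₁, Uo₁))` on the class `(s₁, U₁, n)` with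
`2σ₁ = κ₁` (a target-slot read, or the σ-chord of two end objectives on one class — lever zero); the second member is a free-gas floor `ℓ₂ ≤ e(1, κ₂, 0, n)`. Then
`ObsStiffnessSeqCeilingAt t′_P U_P n c` for every `c ≥ μ₁(−v₁) + μ₂(−ℓ₂/4)`. [cite: KomaTasaki1994, §1] [cite: ScalapinoWhiteZhang1993, §II] [cite: LiebLoss1993, §8, Theorem 8.2] -/
theorem ObsStiffnessSeqCeilingAt_of_apexSource_fermiSeaRow_weighted_of_slot (Uo₁ : ℝ) (hU₁0 : 0 ≤ U₁) (hU₁ : U₁ < UP)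
    (hn0 : 0 ≤ n) (hn2 : n < 2) {μ₁ μ₂ : ℝ} (hμ₁ : 0 ≤ μ₁) (hμ₂ : 0 ≤ μ₂) (hμ : μ₁ + μ₂ = 1) (κ₂ : ℝ)
    (hκ : μ₁ * ((UP * s₁ - U₁ * t'P) / (UP - U₁)) + μ₂ * κ₂ = 2 * t'P) {σ₁ : ℝ}
    (hσ₁ : 2 * σ₁ = (UP * s₁ - U₁ * t'P) / (UP - U₁)) {v₁ ℓ₂ : ℝ}
    (h₁ : ∀ (ω : InfVolFermionState 2) (Ls : ℕ → ℕ) (ψ : ∀ L, Fock (Orb (FermionTorus 2 L))),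
      Tendsto Ls atTop atTop →
      (∀ j, IsGroundStateInSector (hubbardTorusTT' (Ls j) 1 s₁ U₁) (rectN n (Ls j)) 0 (ψ (Ls j))) →
      (∀ j, star (ψ (Ls j)) ⬝ᵥ ψ (Ls j) = 1) → ω.IsTorusLimitOf ψ Ls →
      v₁ ≤ ((Finset.univ : Finset (DihedralGroup 4)).card : ℝ)⁻¹ * ∑ g ∈ (Finset.univ : Finset (DihedralGroup 4)),
        (ω.expect (d4ShiftSet g 0 (box 2 7)) (fermionEmbed (PolySite.d4Emb g 0 (box 2 7)) (-oddMomentObsTT σ₁ Uo₁ 0))).re)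
    (h₂ : ℓ₂ ≤ energyDensityTT' 1 κ₂ 0 n)
    (c : ℚ) (hc : μ₁ * (-v₁) + μ₂ * (-ℓ₂ / 4) ≤ ((c : ℚ) : ℝ)) :
    ObsStiffnessSeqCeilingAt t'P UP n c :=
  ObsStiffnessSeqCeilingAt_of_apexSource_fermiSeaRow_weighted hU₁0 hU₁ hn0 hn2 hμ₁ hμ₂ hμ κ₂ hκ
    (hoppingFloor_of_slot_orbitLower Uo₁ v₁ hσ₁ h₁) h₂ c (by linarith)

/-- **APEX × FERMI-SEA, «own-word-and-floor» edition.** The source floor is the class `(s₁, U₁, n)`'s OWN f-sum orbit-lower family `v₁` at the slot `s₁` plus a floor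
`B₁ ≤ K₂` on the class, floor orientation `2s₁ ≤ κ₁` (the target lies RIGHT of the line of apex hopping `2s₁` through the source; price `(κ₁ − 2s₁)(−B₁)/4 ≥ 0` when `B₁ ≤ 0`);
the second member is a free-gas floor `ℓ₂ ≤ e(1, κ₂, 0, n)`. Then `ObsStiffnessSeqCeilingAt t′_P U_P n c` for every `c ≥ μ₁(−v₁ − (κ₁ − 2s₁)B₁/4) + μ₂(−ℓ₂/4)`.
[cite: KomaTasaki1994, §1] [cite: ScalapinoWhiteZhang1993, §II] [cite: LiebLoss1993, §8, Theorem 8.2] -/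
theorem ObsStiffnessSeqCeilingAt_of_apexSource_fermiSeaRow_weighted_of_fsumFloor (Uo₁ : ℝ) (hU₁0 : 0 ≤ U₁) (hU₁ : U₁ < UP)
    (hn0 : 0 ≤ n) (hn2 : n < 2) {μ₁ μ₂ : ℝ} (hμ₁ : 0 ≤ μ₁) (hμ₂ : 0 ≤ μ₂) (hμ : μ₁ + μ₂ = 1) (κ₂ : ℝ)
    (hκ : μ₁ * ((UP * s₁ - U₁ * t'P) / (UP - U₁)) + μ₂ * κ₂ = 2 * t'P)
    (h2s₁ : 2 * s₁ ≤ (UP * s₁ - U₁ * t'P) / (UP - U₁)) {v₁ ℓ₂ : ℝ}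
    (h₁ : ∀ (ω : InfVolFermionState 2) (Ls : ℕ → ℕ) (ψ : ∀ L, Fock (Orb (FermionTorus 2 L))),
      Tendsto Ls atTop atTop →
      (∀ j, IsGroundStateInSector (hubbardTorusTT' (Ls j) 1 s₁ U₁) (rectN n (Ls j)) 0 (ψ (Ls j))) →
      (∀ j, star (ψ (Ls j)) ⬝ᵥ ψ (Ls j) = 1) → ω.IsTorusLimitOf ψ Ls →
      v₁ ≤ ((Finset.univ : Finset (DihedralGroup 4)).card : ℝ)⁻¹ * ∑ g ∈ (Finset.univ : Finset (DihedralGroup 4)),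
        (ω.expect (d4ShiftSet g 0 (box 2 7)) (fermionEmbed (PolySite.d4Emb g 0 (box 2 7)) (-oddMomentObsTT s₁ Uo₁ 0))).re)
    {B₁ : ℝ}
    (hB₁ : ∀ (ω : InfVolFermionState 2) (Ls : ℕ → ℕ) (ψ : ∀ L, Fock (Orb (FermionTorus 2 L))),
      Tendsto Ls atTop atTop →
      (∀ j, IsGroundStateInSector (hubbardTorusTT' (Ls j) 1 s₁ U₁) (rectN n (Ls j)) 0 (ψ (Ls j))) →
      (∀ j, star (ψ (Ls j)) ⬝ᵥ ψ (Ls j) = 1) → ω.IsTorusLimitOf ψ Ls →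
      B₁ ≤ ω.meanEnergy (hubbardTTPrimeFermionInteraction 0 1 0) 1)
    (h₂ : ℓ₂ ≤ energyDensityTT' 1 κ₂ 0 n)
    (c : ℚ) (hc : μ₁ * (-v₁ - ((UP * s₁ - U₁ * t'P) / (UP - U₁) - 2 * s₁) * B₁ / 4) + μ₂ * (-ℓ₂ / 4) ≤ ((c : ℚ) : ℝ)) :
    ObsStiffnessSeqCeilingAt t'P UP n c :=
  ObsStiffnessSeqCeilingAt_of_apexSource_fermiSeaRow_weighted hU₁0 hU₁ hn0 hn2 hμ₁ hμ₂ hμ κ₂ hκ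
    (hoppingFloor_of_ownSlot_orbitLower_of_le_diagHop Uo₁ v₁ h2s₁ h₁ hB₁) h₂ c (by
      have e : -(μ₁ * (4 * v₁ + ((UP * s₁ - U₁ * t'P) / (UP - U₁) - 2 * s₁) * B₁) + μ₂ * ℓ₂) / 4 =
          μ₁ * (-v₁ - ((UP * s₁ - U₁ * t'P) / (UP - U₁) - 2 * s₁) * B₁ / 4) + μ₂ * (-ℓ₂ / 4) := by ring
      rw [e]; exact hc)

/-- **APEX × FERMI-SEA, «own-word-and-ceiling» edition.** The source floor is the class `(s₁, U₁, n)`'s OWN f-sum orbit-lower family `v₁` at the slot `s₁` plus a CEILING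
`K₂ ≤ A₁` on the class, used BEYOND the slot: orientation `κ₁ ≤ 2s₁` (the target lies LEFT of the line of apex hopping `2s₁` through the source; price `(2s₁ − κ₁)A₁/4 ≥ 0` when
`A₁ ≥ 0`, e.g. the hypothesis-free kinematic ceiling `forall_torusLimit_diagHop_le_kinematic`); the second member is a free-gas floor `ℓ₂ ≤ e(1, κ₂, 0, n)`. Then
`ObsStiffnessSeqCeilingAt t′_P U_P n c` for every `c ≥ μ₁(−v₁ − (κ₁ − 2s₁)A₁/4) + μ₂(−ℓ₂/4)`. [cite: KomaTasaki1994, §1] [cite: ScalapinoWhiteZhang1993, §II] [cite: LiebLoss1993, §8, Theorem 8.2] -/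
theorem ObsStiffnessSeqCeilingAt_of_apexSource_fermiSeaRow_weighted_of_fsumCeil (Uo₁ : ℝ) (hU₁0 : 0 ≤ U₁) (hU₁ : U₁ < UP)
    (hn0 : 0 ≤ n) (hn2 : n < 2) {μ₁ μ₂ : ℝ} (hμ₁ : 0 ≤ μ₁) (hμ₂ : 0 ≤ μ₂) (hμ : μ₁ + μ₂ = 1) (κ₂ : ℝ)
    (hκ : μ₁ * ((UP * s₁ - U₁ * t'P) / (UP - U₁)) + μ₂ * κ₂ = 2 * t'P)
    (h2s₁ : (UP * s₁ - U₁ * t'P) / (UP - U₁) ≤ 2 * s₁) {v₁ ℓ₂ : ℝ}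
    (h₁ : ∀ (ω : InfVolFermionState 2) (Ls : ℕ → ℕ) (ψ : ∀ L, Fock (Orb (FermionTorus 2 L))),
      Tendsto Ls atTop atTop →
      (∀ j, IsGroundStateInSector (hubbardTorusTT' (Ls j) 1 s₁ U₁) (rectN n (Ls j)) 0 (ψ (Ls j))) →
      (∀ j, star (ψ (Ls j)) ⬝ᵥ ψ (Ls j) = 1) → ω.IsTorusLimitOf ψ Ls →
      v₁ ≤ ((Finset.univ : Finset (DihedralGroup 4)).card : ℝ)⁻¹ * ∑ g ∈ (Finset.univ : Finset (DihedralGroup 4)),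
        (ω.expect (d4ShiftSet g 0 (box 2 7)) (fermionEmbed (PolySite.d4Emb g 0 (box 2 7)) (-oddMomentObsTT s₁ Uo₁ 0))).re)
    {A₁ : ℝ}
    (hA₁ : ∀ (ω : InfVolFermionState 2) (Ls : ℕ → ℕ) (ψ : ∀ L, Fock (Orb (FermionTorus 2 L))),
      Tendsto Ls atTop atTop →
      (∀ j, IsGroundStateInSector (hubbardTorusTT' (Ls j) 1 s₁ U₁) (rectN n (Ls j)) 0 (ψ (Ls j))) →
      (∀ j, star (ψ (Ls j)) ⬝ᵥ ψ (Ls j) = 1) → ω.IsTorusLimitOf ψ Ls →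
      ω.meanEnergy (hubbardTTPrimeFermionInteraction 0 1 0) 1 ≤ A₁)
    (h₂ : ℓ₂ ≤ energyDensityTT' 1 κ₂ 0 n)
    (c : ℚ) (hc : μ₁ * (-v₁ - ((UP * s₁ - U₁ * t'P) / (UP - U₁) - 2 * s₁) * A₁ / 4) + μ₂ * (-ℓ₂ / 4) ≤ ((c : ℚ) : ℝ)) :
    ObsStiffnessSeqCeilingAt t'P UP n c :=
  ObsStiffnessSeqCeilingAt_of_apexSource_fermiSeaRow_weighted hU₁0 hU₁ hn0 hn2 hμ₁ hμ₂ hμ κ₂ hκ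
    (hoppingFloor_of_ownSlot_orbitLower_of_diagHop_le Uo₁ v₁ h2s₁ h₁ hA₁) h₂ c (by
      have e : -(μ₁ * (4 * v₁ + ((UP * s₁ - U₁ * t'P) / (UP - U₁) - 2 * s₁) * A₁) + μ₂ * ℓ₂) / 4 =
          μ₁ * (-v₁ - ((UP * s₁ - U₁ * t'P) / (UP - U₁) - 2 * s₁) * A₁ / 4) + μ₂ * (-ℓ₂ / 4) := by ring
      rw [e]; exact hc)

/-- **APEX × FERMI-SEA, «registry row» edition.** The source floor is a certified f-sum orbit ROW `r₁` (cap `u₁`, discharged by `e₀ ≤ u₁`) at `(s₁, U₁, n)` plus a floor `B₁ ≤ K₂`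
on the class, orientation `2s₁ ≤ κ₁`; the second member is a free-gas floor `ℓ₂ ≤ e(1, κ₂, 0, n)`. Then `ObsStiffnessSeqCeilingAt t′_P U_P n c` for every
`c ≥ μ₁(−r₁ − (κ₁ − 2s₁)B₁/4) + μ₂(−ℓ₂/4)`. [cite: KomaTasaki1994, §1] [cite: ScalapinoWhiteZhang1993, §II] [cite: LiebLoss1993, §8, Theorem 8.2] -/
theorem ObsStiffnessSeqCeilingAt_of_apexSource_fermiSeaRow_weighted_of_fsumRow (Uo₁ : ℝ) (hU₁0 : 0 ≤ U₁) (hU₁ : U₁ < UP)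
    (hn0 : 0 ≤ n) (hn2 : n < 2) {μ₁ μ₂ : ℝ} (hμ₁ : 0 ≤ μ₁) (hμ₂ : 0 ≤ μ₂) (hμ : μ₁ + μ₂ = 1) (κ₂ : ℝ)
    (hκ : μ₁ * ((UP * s₁ - U₁ * t'P) / (UP - U₁)) + μ₂ * κ₂ = 2 * t'P)
    (h2s₁ : 2 * s₁ ≤ (UP * s₁ - U₁ * t'P) / (UP - U₁)) {u₁ r₁ : ℚ}
    (hrow₁ : SquareTTPrimeCorrOrbitLowerRow s₁ U₁ n u₁ r₁ Finset.univ (box 2 7) (-oddMomentObsTT s₁ Uo₁ 0))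
    (hu₁ : energyDensityTT' 1 s₁ U₁ n ≤ ((u₁ : ℚ) : ℝ)) {B₁ ℓ₂ : ℝ}
    (hB₁ : ∀ (ω : InfVolFermionState 2) (Ls : ℕ → ℕ) (ψ : ∀ L, Fock (Orb (FermionTorus 2 L))),
      Tendsto Ls atTop atTop →
      (∀ j, IsGroundStateInSector (hubbardTorusTT' (Ls j) 1 s₁ U₁) (rectN n (Ls j)) 0 (ψ (Ls j))) →
      (∀ j, star (ψ (Ls j)) ⬝ᵥ ψ (Ls j) = 1) → ω.IsTorusLimitOf ψ Ls →
      B₁ ≤ ω.meanEnergy (hubbardTTPrimeFermionInteraction 0 1 0) 1)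
    (h₂ : ℓ₂ ≤ energyDensityTT' 1 κ₂ 0 n)
    (c : ℚ) (hc : μ₁ * (-((r₁ : ℚ) : ℝ) - ((UP * s₁ - U₁ * t'P) / (UP - U₁) - 2 * s₁) * B₁ / 4) + μ₂ * (-ℓ₂ / 4) ≤ ((c : ℚ) : ℝ)) :
    ObsStiffnessSeqCeilingAt t'P UP n c :=
  ObsStiffnessSeqCeilingAt_of_apexSource_fermiSeaRow_weighted_of_fsumFloor Uo₁ hU₁0 hU₁ hn0 hn2 hμ₁ hμ₂ hμ κ₂ hκ h2s₁
    (orbitLower_of_orbitLowerRow Uo₁ hrow₁ hu₁) hB₁ h₂ c hc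

end Shapes

/-! ## §3 Arithmetic: the weights when the Fermi-sea hopping lies LEFT of the target hopping -/

/-- **Weights of a left anchor.** If `κ₂ < κ₁` and `κ₂ ≤ τ ≤ κ₁` then `μ₁ = (τ − κ₂)/(κ₁ − κ₂)`, `μ₂ = (κ₁ − τ)/(κ₁ − κ₂)` are `≥ 0`, sum to `1` and `μ₁κ₁ + μ₂κ₂ = τ`
(the mirror of the companion's `bracket_weights`, for a Fermi-sea row at a hopping BELOW `2t′_P` and an interacting source above it). [folklore] -/
theorem anchor_weights_left {κ₁ κ₂ τ : ℝ} (hκ : κ₂ < κ₁) (h₂ : κ₂ ≤ τ) (h₁ : τ ≤ κ₁) :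
    0 ≤ (τ - κ₂) / (κ₁ - κ₂) ∧ 0 ≤ (κ₁ - τ) / (κ₁ - κ₂) ∧ (τ - κ₂) / (κ₁ - κ₂) + (κ₁ - τ) / (κ₁ - κ₂) = 1 ∧
      (τ - κ₂) / (κ₁ - κ₂) * κ₁ + (κ₁ - τ) / (κ₁ - κ₂) * κ₂ = τ := by
  have hd : 0 < κ₁ - κ₂ := sub_pos.2 hκ
  refine ⟨div_nonneg (by linarith) hd.le, div_nonneg (by linarith) hd.le, ?_, ?_⟩
  · field_simp; ring
  · field_simp; ring

/-! ## §4 (append, same seat, same session) The free-gas floor BETWEEN two kernel rows: concavity in the hopping -/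

section ChordFloor

/-- **Fermi-sea CHORD floor.** The free energy density `κ ↦ e(1, κ, 0, n)` is concave (`concaveOn_energyDensityTT'_tPrime`), so two free-gas floors `ℓ_a ≤ e(1,κ_a,0,n)`,
`ℓ_b ≤ e(1,κ_b,0,n)` (e.g. two kernel Fermi-sea rows) give the floor `pℓ_a + qℓ_b ≤ e(1, pκ_a + qκ_b, 0, n)` at every convex combination (`p, q ≥ 0`, `p + q = 1`):
a MOVING anchor for the bracket of §1, affine in its position — what a continuum (section) word needs. [cite: LiebLoss1993, §8, Theorem 8.2] [cite: Ruelle1969, §3.4] -/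
theorem fermiSea_chordFloor {n κa κb ℓa ℓb : ℝ} (hn0 : 0 ≤ n) (hn2 : n < 2)
    (ha : ℓa ≤ energyDensityTT' 1 κa 0 n) (hb : ℓb ≤ energyDensityTT' 1 κb 0 n) {p q : ℝ} (hp : 0 ≤ p) (hq : 0 ≤ q) (hpq : p + q = 1) :
    p * ℓa + q * ℓb ≤ energyDensityTT' 1 (p * κa + q * κb) 0 n := by
  have h := (concaveOn_energyDensityTT'_tPrime 1 (le_refl (0 : ℝ)) hn0 hn2).2 (Set.mem_univ κa) (Set.mem_univ κb) hp hq hpq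
  simp only [smul_eq_mul] at h
  have h₁ := mul_le_mul_of_nonneg_left ha hp
  have h₂ := mul_le_mul_of_nonneg_left hb hq
  linarith

/-- **APEX × FERMI-SEA CHORD, «own-word-and-floor» edition** — the `_of_fsumFloor` shape of §2 with the free-gas member placed at a convex combination `pκ_a + qκ_b` of two kernel
rows (floor `pℓ_a + qℓ_b` by `fermiSea_chordFloor`). With `p, q, μ₁, μ₂` affine in `t′` (gap `κ₂ − κ₁` held constant along a vertical section) every hypothesis is affine and the word
is a quadratic in `t′` — the section device of the cells files. [cite: KomaTasaki1994, §1] [cite: ScalapinoWhiteZhang1993, §II] [cite: LiebLoss1993, §8, Theorem 8.2] -/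
theorem ObsStiffnessSeqCeilingAt_of_apexSource_fermiSeaChord_weighted_of_fsumFloor {t'P UP n s₁ U₁ : ℝ} (Uo₁ : ℝ) (hU₁0 : 0 ≤ U₁) (hU₁ : U₁ < UP)
    (hn0 : 0 ≤ n) (hn2 : n < 2) {μ₁ μ₂ : ℝ} (hμ₁ : 0 ≤ μ₁) (hμ₂ : 0 ≤ μ₂) (hμ : μ₁ + μ₂ = 1) {κa κb p q : ℝ} (hp : 0 ≤ p) (hq : 0 ≤ q) (hpq : p + q = 1)
    (hκ : μ₁ * ((UP * s₁ - U₁ * t'P) / (UP - U₁)) + μ₂ * (p * κa + q * κb) = 2 * t'P)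
    (h2s₁ : 2 * s₁ ≤ (UP * s₁ - U₁ * t'P) / (UP - U₁)) {v₁ ℓa ℓb : ℝ}
    (h₁ : ∀ (ω : InfVolFermionState 2) (Ls : ℕ → ℕ) (ψ : ∀ L, Fock (Orb (FermionTorus 2 L))),
      Tendsto Ls atTop atTop →
      (∀ j, IsGroundStateInSector (hubbardTorusTT' (Ls j) 1 s₁ U₁) (rectN n (Ls j)) 0 (ψ (Ls j))) →
      (∀ j, star (ψ (Ls j)) ⬝ᵥ ψ (Ls j) = 1) → ω.IsTorusLimitOf ψ Ls →
      v₁ ≤ ((Finset.univ : Finset (DihedralGroup 4)).card : ℝ)⁻¹ * ∑ g ∈ (Finset.univ : Finset (DihedralGroup 4)),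
        (ω.expect (d4ShiftSet g 0 (box 2 7)) (fermionEmbed (PolySite.d4Emb g 0 (box 2 7)) (-oddMomentObsTT s₁ Uo₁ 0))).re)
    {B₁ : ℝ}
    (hB₁ : ∀ (ω : InfVolFermionState 2) (Ls : ℕ → ℕ) (ψ : ∀ L, Fock (Orb (FermionTorus 2 L))),
      Tendsto Ls atTop atTop →
      (∀ j, IsGroundStateInSector (hubbardTorusTT' (Ls j) 1 s₁ U₁) (rectN n (Ls j)) 0 (ψ (Ls j))) →
      (∀ j, star (ψ (Ls j)) ⬝ᵥ ψ (Ls j) = 1) → ω.IsTorusLimitOf ψ Ls →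
      B₁ ≤ ω.meanEnergy (hubbardTTPrimeFermionInteraction 0 1 0) 1)
    (ha : ℓa ≤ energyDensityTT' 1 κa 0 n) (hb : ℓb ≤ energyDensityTT' 1 κb 0 n)
    (c : ℚ) (hc : μ₁ * (-v₁ - ((UP * s₁ - U₁ * t'P) / (UP - U₁) - 2 * s₁) * B₁ / 4) + μ₂ * (-(p * ℓa + q * ℓb) / 4) ≤ ((c : ℚ) : ℝ)) :
    ObsStiffnessSeqCeilingAt t'P UP n c :=
  ObsStiffnessSeqCeilingAt_of_apexSource_fermiSeaRow_weighted_of_fsumFloor Uo₁ hU₁0 hU₁ hn0 hn2 hμ₁ hμ₂ hμ (p * κa + q * κb) hκ h2s₁ h₁ hB₁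
    (fermiSea_chordFloor hn0 hn2 ha hb hp hq hpq) c hc

/-- **APEX × FERMI-SEA CHORD, «own-word-and-ceiling» edition** (`κ₁ ≤ 2s₁`, `K₂ ≤ A₁` on the source class). [cite: KomaTasaki1994, §1] [cite: LiebLoss1993, §8, Theorem 8.2] -/
theorem ObsStiffnessSeqCeilingAt_of_apexSource_fermiSeaChord_weighted_of_fsumCeil {t'P UP n s₁ U₁ : ℝ} (Uo₁ : ℝ) (hU₁0 : 0 ≤ U₁) (hU₁ : U₁ < UP)
    (hn0 : 0 ≤ n) (hn2 : n < 2) {μ₁ μ₂ : ℝ} (hμ₁ : 0 ≤ μ₁) (hμ₂ : 0 ≤ μ₂) (hμ : μ₁ + μ₂ = 1) {κa κb p q : ℝ} (hp : 0 ≤ p) (hq : 0 ≤ q) (hpq : p + q = 1)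
    (hκ : μ₁ * ((UP * s₁ - U₁ * t'P) / (UP - U₁)) + μ₂ * (p * κa + q * κb) = 2 * t'P)
    (h2s₁ : (UP * s₁ - U₁ * t'P) / (UP - U₁) ≤ 2 * s₁) {v₁ ℓa ℓb : ℝ}
    (h₁ : ∀ (ω : InfVolFermionState 2) (Ls : ℕ → ℕ) (ψ : ∀ L, Fock (Orb (FermionTorus 2 L))),
      Tendsto Ls atTop atTop →
      (∀ j, IsGroundStateInSector (hubbardTorusTT' (Ls j) 1 s₁ U₁) (rectN n (Ls j)) 0 (ψ (Ls j))) →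
      (∀ j, star (ψ (Ls j)) ⬝ᵥ ψ (Ls j) = 1) → ω.IsTorusLimitOf ψ Ls →
      v₁ ≤ ((Finset.univ : Finset (DihedralGroup 4)).card : ℝ)⁻¹ * ∑ g ∈ (Finset.univ : Finset (DihedralGroup 4)),
        (ω.expect (d4ShiftSet g 0 (box 2 7)) (fermionEmbed (PolySite.d4Emb g 0 (box 2 7)) (-oddMomentObsTT s₁ Uo₁ 0))).re)
    {A₁ : ℝ}
    (hA₁ : ∀ (ω : InfVolFermionState 2) (Ls : ℕ → ℕ) (ψ : ∀ L, Fock (Orb (FermionTorus 2 L))),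
      Tendsto Ls atTop atTop →
      (∀ j, IsGroundStateInSector (hubbardTorusTT' (Ls j) 1 s₁ U₁) (rectN n (Ls j)) 0 (ψ (Ls j))) →
      (∀ j, star (ψ (Ls j)) ⬝ᵥ ψ (Ls j) = 1) → ω.IsTorusLimitOf ψ Ls →
      ω.meanEnergy (hubbardTTPrimeFermionInteraction 0 1 0) 1 ≤ A₁)
    (ha : ℓa ≤ energyDensityTT' 1 κa 0 n) (hb : ℓb ≤ energyDensityTT' 1 κb 0 n)
    (c : ℚ) (hc : μ₁ * (-v₁ - ((UP * s₁ - U₁ * t'P) / (UP - U₁) - 2 * s₁) * A₁ / 4) + μ₂ * (-(p * ℓa + q * ℓb) / 4) ≤ ((c : ℚ) : ℝ)) :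
    ObsStiffnessSeqCeilingAt t'P UP n c :=
  ObsStiffnessSeqCeilingAt_of_apexSource_fermiSeaRow_weighted_of_fsumCeil Uo₁ hU₁0 hU₁ hn0 hn2 hμ₁ hμ₂ hμ (p * κa + q * κb) hκ h2s₁ h₁ hA₁
    (fermiSea_chordFloor hn0 hn2 ha hb hp hq hpq) c hc

/-- **APEX × FERMI-SEA CHORD, «slot» edition** (left = END-objective family / σ-chord at the slot `2σ₁ = κ₁`). [cite: KomaTasaki1994, §1] [cite: LiebLoss1993, §8, Theorem 8.2] -/
theorem ObsStiffnessSeqCeilingAt_of_apexSource_fermiSeaChord_weighted_of_slot {t'P UP n s₁ U₁ : ℝ} (Uo₁ : ℝ) (hU₁0 : 0 ≤ U₁) (hU₁ : U₁ < UP)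
    (hn0 : 0 ≤ n) (hn2 : n < 2) {μ₁ μ₂ : ℝ} (hμ₁ : 0 ≤ μ₁) (hμ₂ : 0 ≤ μ₂) (hμ : μ₁ + μ₂ = 1) {κa κb p q : ℝ} (hp : 0 ≤ p) (hq : 0 ≤ q) (hpq : p + q = 1)
    (hκ : μ₁ * ((UP * s₁ - U₁ * t'P) / (UP - U₁)) + μ₂ * (p * κa + q * κb) = 2 * t'P) {σ₁ : ℝ}
    (hσ₁ : 2 * σ₁ = (UP * s₁ - U₁ * t'P) / (UP - U₁)) {v₁ ℓa ℓb : ℝ}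
    (h₁ : ∀ (ω : InfVolFermionState 2) (Ls : ℕ → ℕ) (ψ : ∀ L, Fock (Orb (FermionTorus 2 L))),
      Tendsto Ls atTop atTop →
      (∀ j, IsGroundStateInSector (hubbardTorusTT' (Ls j) 1 s₁ U₁) (rectN n (Ls j)) 0 (ψ (Ls j))) →
      (∀ j, star (ψ (Ls j)) ⬝ᵥ ψ (Ls j) = 1) → ω.IsTorusLimitOf ψ Ls →
      v₁ ≤ ((Finset.univ : Finset (DihedralGroup 4)).card : ℝ)⁻¹ * ∑ g ∈ (Finset.univ : Finset (DihedralGroup 4)),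
        (ω.expect (d4ShiftSet g 0 (box 2 7)) (fermionEmbed (PolySite.d4Emb g 0 (box 2 7)) (-oddMomentObsTT σ₁ Uo₁ 0))).re)
    (ha : ℓa ≤ energyDensityTT' 1 κa 0 n) (hb : ℓb ≤ energyDensityTT' 1 κb 0 n)
    (c : ℚ) (hc : μ₁ * (-v₁) + μ₂ * (-(p * ℓa + q * ℓb) / 4) ≤ ((c : ℚ) : ℝ)) :
    ObsStiffnessSeqCeilingAt t'P UP n c :=
  ObsStiffnessSeqCeilingAt_of_apexSource_fermiSeaRow_weighted_of_slot Uo₁ hU₁0 hU₁ hn0 hn2 hμ₁ hμ₂ hμ (p * κa + q * κb) hκ hσ₁ h₁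
    (fermiSea_chordFloor hn0 hn2 ha hb hp hq hpq) c hc

end ChordFloor

/-! ## §5 (append, same seat, same session) Arithmetic for SECTION words with rational weights (denominator clearing) -/

/-- **Clearing a common positive denominator in a two-term weighted sum**: `aW₁ + bW₂ ≤ cD`, `D > 0` ⇒ `(a/D)W₁ + (b/D)W₂ ≤ c` — the word inequality of a bracket whose
two hoppings are both forced by the geometry (weights `(κ₂ − 2t′)/(κ₂ − κ₁)`, `(2t′ − κ₁)/(κ₂ − κ₁)`). [folklore] -/
theorem weighted_div_le_of_mul_le {a b D W₁ W₂ c : ℝ} (hD : 0 < D) (h : a * W₁ + b * W₂ ≤ c * D) :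
    a / D * W₁ + b / D * W₂ ≤ c := by
  rw [div_mul_eq_mul_div, div_mul_eq_mul_div, ← add_div, div_le_iff₀ hD]; exact h

/-- **The same for an identity** (the barycentre condition `μ₁κ₁ + μ₂κ₂ = 2t′` with rational weights): `aX + bY = rD`, `D ≠ 0` ⇒ `(a/D)X + (b/D)Y = r`. [folklore] -/
theorem weighted_div_eq_of_mul_eq {a b D X Y r : ℝ} (hD : D ≠ 0) (h : a * X + b * Y = r * D) :
    a / D * X + b / D * Y = r := by
  rw [div_mul_eq_mul_div, div_mul_eq_mul_div, ← add_div, div_eq_iff hD]; exact h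

end Summit.Ventures.CertifiedManyBodySolver.Observables

end
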